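import Summits.QuantumFields.YangMills.Theorems.BalabanUVNodesN14ConvexFibrePerturb
import Summits.QuantumFields.BalabanUV.T4Continuum.Spine.NE7b.SupTorusActionConvexEuclid

/-!
# BalabanUVNodes ∕ node N14 = NE1′ — JUNCTION WITH THE NE7b CONVEXITY ROAD: a TEA-class action (symmetric operator with a form floor `γ`,
# site potential with `u′ ≥ −λ`) on a small-field BOX feeds the convex-fibre engine BY NAME — Herbst constant `L²∕(γ − λ)`

Cell `pub-ymgap`, HUMAN RULING D-0062 (Track A at full width), seat `pub-ymgap-dag-n14-c` (R134 ACCELERATION, strategy s1), generation 4;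
route `Summits/QuantumFields/YangMills/Theses/BalabanUVNodes.lean` (cluster K3′ `SpineGivenEndpointR12`, `--supports … --as helper`); venue
ruling R424 (`YangMills/Theorems`, namespace `YMDAG.N14.ConvexFibreTEA`).  Ninth file of the convex-fibre engine.  ADDITIVE — imports F
(`…ConvexFibrePerturb`: the box engine in Mathlib's `StrongConvexOn` currency) and the NE7b row OWNER's `Spine/NE7b/SupTorusActionConvexEuclid`
(`strongConvexOn_action_euclid`, `continuous_action_euclid` — CITED, nothing of NE7b's re-declared); THEOREMS ONLY (0 `def`), modifies nothing.

WHY.  The NE7b convexity road types Bałaban-style lattice actions `S φ = ½Σ_x φ_x (At φ)_x + Σ_x v(φ_x)` (TEA: `At` symmetric with form floor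
`γ·Σh² ≤ Σ h·(At h)`, `v′ = u`, `u′ ≥ −λ`) and PROVES `StrongConvexOn K (γ − λ) S` on every convex window of `EuclideanSpace ℝ ι`
(`SupTorusActionConvexEuclid.strongConvexOn_action_euclid`; the torus and `φ⁴` actions are instances, `torus_strongConvexOn_action(_reindexed)`,
`phiFour_strongConvexOn_action`).  File F §4 consumes exactly `StrongConvexOn Ω c V` on an open convex box.  This file is the one-line
junction, so that the NE7b lineage's actions are fibre actions of the N14 engine BY NAME.

WHAT THIS IS.
* `integrableOn_exp_neg_of_continuous_isBounded` [folklore] (a continuous weight is integrable on a bounded set);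
* **`hasSubgaussianMGF_box_of_teaAction`** — TEA letters with `λ < γ`, `Ω ⊆ EuclideanSpace ℝ (Fin n)` open, convex, bounded, of nonzero volume,
  `G ∈ C¹` bounded with `‖DG‖ ≤ L` (`L > 0`) ⇒ under the box law `(volume.restrict Ω).tilted (−S)`: `HasSubgaussianMGF (G − ∫G) ⟨L²∕(γ − λ)⟩`;
* `bornCumulant_box_le_of_teaAction` — `cgf G ν_Ω t − t·∫G dν_Ω ≤ (L²∕(γ − λ))·t²∕2`.

WHAT THIS IS NOT.  Everything here is PROVED (0 `sorry`, 0 named facts).  Which operator `At`, floor `γ`, potential `v` and box `Ω` realise Bałaban's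
history-conditioned small-field fibre action of record is NODE O's object (the NE7b torus∕`φ⁴` instances are the scalar caricature, (A3) ∕ NC-NE7b-α
UNRULED for the gauge model); nothing of Bałaban's instantiated; N14 NOT discharged; count-neutral.  One finite four-torus programme at fixed ε;
NOT ℝ⁴, NOT OS, NOT a mass gap, NOT Clay.
-/

noncomputable section

namespace YMDAG.N14.ConvexFibreTEA

open MeasureTheory ProbabilityTheory Set Filter Topology
open scoped RealInnerProductSpace ENNReal NNReal
open Summit.QuantumFields.BalabanUV.T4Continuum.NE7b.SupTorusActionConvexEuclid (strongConvexOn_action_euclid continuous_action_euclid)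
open YMDAG.N14.CovGradEngine (bornCumulant_le_of_hasSubgaussianMGF)
open YMDAG.N14.ConvexFibreBox (isProbabilityMeasure_restrict_tilted)
open YMDAG.N14.ConvexFibrePerturb (hasSubgaussianMGF_box_of_strongConvexOn)

variable {n : ℕ}

/-- A continuous weight `e^{−S}` is integrable on a bounded set (continuous on the compact closed ball containing it). [folklore] -/
theorem integrableOn_exp_neg_of_continuous_isBounded {S : EuclideanSpace ℝ (Fin n) → ℝ} (hS : Continuous S) {Ω : Set (EuclideanSpace ℝ (Fin n))}
    (hΩb : Bornology.IsBounded Ω) : IntegrableOn (fun x => Real.exp (-S x)) Ω := by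
  obtain ⟨R, hR⟩ := hΩb.subset_closedBall 0
  exact ((Real.continuous_exp.comp hS.neg).continuousOn.integrableOn_compact (isCompact_closedBall 0 R)).mono_set hR

variable {At : (Fin n → ℝ) →L[ℝ] (Fin n → ℝ)} {γ lam : ℝ} {v u u' : ℝ → ℝ} {Ω : Set (EuclideanSpace ℝ (Fin n))}
  {G : EuclideanSpace ℝ (Fin n) → ℝ} {B L : ℝ}

/-- **A TEA-CLASS ACTION ON A SMALL-FIELD BOX FEEDS THE ENGINE** [folklore ∘ NE7b `strongConvexOn_action_euclid` ∘ file F §4; cite: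
BobkovLedoux2000, Prop. 3.1; BakryGentilLedoux2014, Prop. 5.4.1 — PROVED in the tree].  `At` symmetric with form floor `γ`, `v′ = u`, `u′ ≥ −λ`,
`λ < γ`; `Ω` open, convex, bounded, `volume Ω ≠ 0`; `G ∈ C¹` with `|G| ≤ B`, `‖DG‖ ≤ L`, `L > 0`.  With the action
`S φ = ½Σ_x φ_x (At φ)_x + Σ_x v(φ_x)` (read through `WithLp.ofLp`) and the box law `ν_Ω = (volume.restrict Ω).tilted (−S)`:
`HasSubgaussianMGF (G − ∫G dν_Ω) ⟨L²∕(γ − λ)⟩ ν_Ω`. -/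
theorem hasSubgaussianMGF_box_of_teaAction (hAt : ∀ φ ψ : Fin n → ℝ, ∑ x, ψ x * At φ x = ∑ x, φ x * At ψ x)
    (hγ : ∀ h : Fin n → ℝ, γ * ∑ x, h x ^ 2 ≤ ∑ x, h x * At h x) (hv : ∀ t, HasDerivAt v (u t) t) (hu : ∀ t, HasDerivAt u (u' t) t)
    (hu' : ∀ t, -lam ≤ u' t) (hγlam : lam < γ) (hΩo : IsOpen Ω) (hΩc : Convex ℝ Ω) (hΩb : Bornology.IsBounded Ω) (hΩ0 : volume Ω ≠ 0)
    (hG : ContDiff ℝ 1 G) (hGb : ∀ x, |G x| ≤ B) (hGD : ∀ x, ‖fderiv ℝ G x‖ ≤ L) (hL : 0 < L) :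
    HasSubgaussianMGF
      (fun x => G x - ∫ z, G z ∂((volume.restrict Ω).tilted fun φ : EuclideanSpace ℝ (Fin n) =>
        -((1 / 2 : ℝ) * ∑ x, (WithLp.ofLp φ) x * At (WithLp.ofLp φ) x + ∑ x, v ((WithLp.ofLp φ) x))))
      ⟨L ^ 2 / (γ - lam), by have := sub_pos.2 hγlam; positivity⟩
      ((volume.restrict Ω).tilted fun φ : EuclideanSpace ℝ (Fin n) =>
        -((1 / 2 : ℝ) * ∑ x, (WithLp.ofLp φ) x * At (WithLp.ofLp φ) x + ∑ x, v ((WithLp.ofLp φ) x))) :=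
  hasSubgaussianMGF_box_of_strongConvexOn hΩo hΩc hΩ0 (sub_pos.2 hγlam) (strongConvexOn_action_euclid At hAt hγ hv hu hu' hΩc)
    (continuous_action_euclid At hAt hv).continuousOn (integrableOn_exp_neg_of_continuous_isBounded (continuous_action_euclid At hAt hv) hΩb)
    hG hGb hGD hL

/-- **THE BORN CUMULANT OF A TEA-CLASS BOX FIBRE** [folklore]: under the hypotheses of `hasSubgaussianMGF_box_of_teaAction`,
`cgf G ν_Ω t − t·∫G dν_Ω ≤ (L²∕(γ − λ))·t²∕2` for every real `t`. -/
theorem bornCumulant_box_le_of_teaAction (hAt : ∀ φ ψ : Fin n → ℝ, ∑ x, ψ x * At φ x = ∑ x, φ x * At ψ x)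
    (hγ : ∀ h : Fin n → ℝ, γ * ∑ x, h x ^ 2 ≤ ∑ x, h x * At h x) (hv : ∀ t, HasDerivAt v (u t) t) (hu : ∀ t, HasDerivAt u (u' t) t)
    (hu' : ∀ t, -lam ≤ u' t) (hγlam : lam < γ) (hΩo : IsOpen Ω) (hΩc : Convex ℝ Ω) (hΩb : Bornology.IsBounded Ω) (hΩ0 : volume Ω ≠ 0)
    (hG : ContDiff ℝ 1 G) (hGb : ∀ x, |G x| ≤ B) (hGD : ∀ x, ‖fderiv ℝ G x‖ ≤ L) (hL : 0 < L) (t : ℝ) :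
    cgf G ((volume.restrict Ω).tilted fun φ : EuclideanSpace ℝ (Fin n) =>
        -((1 / 2 : ℝ) * ∑ x, (WithLp.ofLp φ) x * At (WithLp.ofLp φ) x + ∑ x, v ((WithLp.ofLp φ) x))) t -
      t * ∫ z, G z ∂((volume.restrict Ω).tilted fun φ : EuclideanSpace ℝ (Fin n) =>
        -((1 / 2 : ℝ) * ∑ x, (WithLp.ofLp φ) x * At (WithLp.ofLp φ) x + ∑ x, v ((WithLp.ofLp φ) x))) ≤
      L ^ 2 / (γ - lam) * t ^ 2 / 2 := by
  haveI := isProbabilityMeasure_restrict_tilted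
    (V := fun φ : EuclideanSpace ℝ (Fin n) => (1 / 2 : ℝ) * ∑ x, (WithLp.ofLp φ) x * At (WithLp.ofLp φ) x + ∑ x, v ((WithLp.ofLp φ) x))
    hΩ0 (integrableOn_exp_neg_of_continuous_isBounded (continuous_action_euclid At hAt hv) hΩb)
  have h := bornCumulant_le_of_hasSubgaussianMGF
    (hasSubgaussianMGF_box_of_teaAction hAt hγ hv hu hu' hγlam hΩo hΩc hΩb hΩ0 hG hGb hGD hL) t
  exact_mod_cast h

end YMDAG.N14.ConvexFibreTEA

end
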